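import Mathlib
import Literature.Computability.AlgebraicComplexity.HessianAtOrigin
import Literature.Computability.AlgebraicComplexity.MignonRessayreBound
import Summits.ValiantsHypothesis.ValiantsHypothesis.Theorems.GrenetZeonTwoDimCoefficientsDualUnipotentConstrainedPencil
import Summits.ValiantsHypothesis.ValiantsHypothesis.Theorems.GrenetZeonTwoDimCoefficientsDualUnipotentThinNumeratorHessian

/-!
# Crux `GrenetZeon.TwoDimCoefficients` (stmt-ValiantsHypothesis-8062) / rung `DualUnipotentThreeHalves` (stmt-24318):
# thin-numerator Hessian bound, part 3 — GAUGE FREEDOM of the numerator and the RESOLVENT (pencil) currency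

Parts 1–2 (✓ `…ThinNumeratorCalculus`, ✓ `…ThinNumeratorHessian`) prove, for affine `A`, `B` with `det A ≡ c ≠ 0` and every
point `p`, `rank Hess_p tr(adj A·B) ≤ 2·m·rank B(p) + 2·rank coeff(B)`.  The right-hand side depends on the PRESENTATION,
the left-hand side only on the polynomial.  This file records the two cheapest ways to move along presentations:

* `trace_adjugate_mul_gauge` / `hess0_transl_trace_adjugate_mul_gauge` — the numerator GAUGE: for every constant matrix
  `G` and scalar `λ`, `tr(adj A·(B + (A·G − G·A) + λ·A)) = tr(adj A·B) + λ·c·m`, so the Hessian at every point is unchanged;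
  ★ `rank_hess0_transl_trace_adjugate_mul_le_numerator_gauge` — hence the thin-numerator bound holds with `B` replaced by
  ANY gauge-equivalent numerator `B + [A, G] + λ·A` (pointwise rank and coefficient rank both taken after the gauge).  Remark
  (paper, not typed): at a point where `A(p) = 1 + N_p` with `N_p` nilpotent, `G` can be chosen along the Jordan chains of
  `N_p` so that `rank(B(p) + [A(p), G]) ≤ dim ker N_p` (number of Jordan blocks); the price is paid in the coefficient term
  `coeff(B + [A, G])`, which is where wild pencils with a fat numerator escape the bound.
* ★ `rank_hess0_transl_resolvent_le_numerator` — the same bound in the CONSTRAINED-PENCIL currency of the 8062/24318 files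
  (✓ `dualUnipotentRepr_iff_constrainedPencil`, ✓ `trace_adjugate_one_sub_mul`): for an affine nilpotent pencil `N`
  (`N^m = 0`) and affine `M`, the resolvent trace `Σ_{j<m} tr(N^j·M)` has `rank Hess_p ≤ 2·m·rank M(p) + 2·rank coeff(M)` at
  every point.

HONEST FRAMING: bookkeeping around a helper of an ASIDE crux; `stub_dualUnipotent`, the rung 24318, `stub_longMassSlowLawInv`
and `VP ≠ VNP` are untouched.  No definitions, no named facts.
-/

noncomputable section

set_option linter.dupNamespace false

namespace Summit.ValiantsHypothesis.ValiantsHypothesis.Theorems.GrenetZeon.ThinNumerator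

open MvPolynomial Matrix
open Literature.Computability.AlgebraicComplexity

/-! ### §6 The numerator gauge `B ↦ B + [A, G] + λ·A` -/

section Gauge

variable {σ : Type*} {m : ℕ}

/-- Right multiplication by a constant matrix keeps entries affine. [folklore] -/
theorem totalDegree_mul_map_C_le (A : Matrix (Fin m) (Fin m) (MvPolynomial σ ℂ))
    (hA : ∀ i j, (A i j).totalDegree ≤ 1) (G : Matrix (Fin m) (Fin m) ℂ) (i j : Fin m) :
    ((A * G.map (C : ℂ → MvPolynomial σ ℂ)) i j).totalDegree ≤ 1 := by
  rw [Matrix.mul_apply]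
  refine (totalDegree_finsetSum _ _).trans (Finset.sup_le fun k _ => ?_)
  rw [Matrix.map_apply]
  exact (totalDegree_mul _ _).trans (by rw [totalDegree_C, add_zero]; exact hA i k)

/-- Left multiplication by a constant matrix keeps entries affine. [folklore] -/
theorem totalDegree_map_C_mul_le (A : Matrix (Fin m) (Fin m) (MvPolynomial σ ℂ))
    (hA : ∀ i j, (A i j).totalDegree ≤ 1) (G : Matrix (Fin m) (Fin m) ℂ) (i j : Fin m) :
    ((G.map (C : ℂ → MvPolynomial σ ℂ) * A) i j).totalDegree ≤ 1 := by
  rw [Matrix.mul_apply]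
  refine (totalDegree_finsetSum _ _).trans (Finset.sup_le fun k _ => ?_)
  rw [Matrix.map_apply]
  exact (totalDegree_mul _ _).trans (by rw [totalDegree_C, zero_add]; exact hA k j)

/-- The gauged numerator `B + (A·G − G·A) + λ·A` is affine. [folklore] -/
theorem isAffine_gauge (A B : Matrix (Fin m) (Fin m) (MvPolynomial σ ℂ))
    (hA : ∀ i j, (A i j).totalDegree ≤ 1) (hB : ∀ i j, (B i j).totalDegree ≤ 1)
    (G : Matrix (Fin m) (Fin m) ℂ) (l : ℂ) (i j : Fin m) :
    ((B + (A * G.map (C : ℂ → MvPolynomial σ ℂ) - G.map (C : ℂ → MvPolynomial σ ℂ) * A) + (C l : MvPolynomial σ ℂ) • A) i j).totalDegree ≤ 1 := by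
  simp only [Matrix.add_apply, Matrix.sub_apply, Matrix.smul_apply, smul_eq_mul]
  refine (totalDegree_add _ _).trans (max_le ((totalDegree_add _ _).trans (max_le (hB i j) ?_)) ?_)
  · exact (totalDegree_sub _ _).trans
      (max_le (totalDegree_mul_map_C_le A hA G i j) (totalDegree_map_C_mul_le A hA G i j))
  · exact (totalDegree_mul _ _).trans (by rw [totalDegree_C, zero_add]; exact hA i j)

/-- **The numerator gauge.**  `tr(adj A·(B + (A·G − G·A) + λ·A)) = tr(adj A·B) + λ·det A·m`:
`tr(adj A·A·G) = tr(A·adj A·G)` (both `det A·tr G`) and `tr(adj A·A) = m·det A`. [folklore] -/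
theorem trace_adjugate_mul_gauge (A B : Matrix (Fin m) (Fin m) (MvPolynomial σ ℂ))
    (G : Matrix (Fin m) (Fin m) ℂ) (l : ℂ) :
    (A.adjugate * (B + (A * G.map (C : ℂ → MvPolynomial σ ℂ) - G.map (C : ℂ → MvPolynomial σ ℂ) * A) + (C l : MvPolynomial σ ℂ) • A)).trace =
      (A.adjugate * B).trace + C l * (A.det * (Fintype.card (Fin m) : MvPolynomial σ ℂ)) := by
  have h1 : (A.adjugate * (A * G.map (C : ℂ → MvPolynomial σ ℂ) - G.map (C : ℂ → MvPolynomial σ ℂ) * A)).trace = 0 := by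
    rw [Matrix.mul_sub, Matrix.trace_sub, ← Matrix.mul_assoc, Matrix.adjugate_mul, ← Matrix.mul_assoc,
      Matrix.trace_mul_cycle A.adjugate (G.map (C : ℂ → MvPolynomial σ ℂ)) A, Matrix.mul_adjugate, sub_self]
  have h2 : (A.adjugate * ((C l : MvPolynomial σ ℂ) • A)).trace =
      C l * (A.det * (Fintype.card (Fin m) : MvPolynomial σ ℂ)) := by
    rw [Matrix.mul_smul, Matrix.trace_smul, Matrix.adjugate_mul, Matrix.trace_smul, Matrix.trace_one,
      smul_eq_mul, smul_eq_mul]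
  rw [Matrix.mul_add, Matrix.mul_add, Matrix.trace_add, Matrix.trace_add, h1, h2, add_zero]

/-- **The Hessian is gauge invariant**: at every point, `Hess_p tr(adj A·(B + [A,G] + λ·A)) = Hess_p tr(adj A·B)`
when `det A ≡ c`. [folklore] -/
theorem hess0_transl_trace_adjugate_mul_gauge (A B : Matrix (Fin m) (Fin m) (MvPolynomial σ ℂ))
    {c : ℂ} (hdet : A.det = C c) (G : Matrix (Fin m) (Fin m) ℂ) (l : ℂ) (p : σ → ℂ) :
    hess0 (transl p (A.adjugate * (B + (A * G.map (C : ℂ → MvPolynomial σ ℂ) - G.map (C : ℂ → MvPolynomial σ ℂ) * A) + (C l : MvPolynomial σ ℂ) • A)).trace) =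
      hess0 (transl p (A.adjugate * B).trace) := by
  rw [trace_adjugate_mul_gauge, hdet, map_add, map_add]
  have hconst : transl p (C l * (C c * (Fintype.card (Fin m) : MvPolynomial σ ℂ))) =
      C (l * (c * (Fintype.card (Fin m) : ℂ))) := by
    rw [← map_natCast (C : ℂ →+* MvPolynomial σ ℂ), ← map_mul, ← map_mul, transl_C]
  have hz : hess0 (C (l * (c * (Fintype.card (Fin m) : ℂ))) : MvPolynomial σ ℂ) = 0 :=
    hess0_eq_zero_of_totalDegree_le_one (by rw [totalDegree_C]; exact Nat.zero_le _)
  rw [hconst, hz, add_zero]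

variable [Fintype σ] [DecidableEq σ]

/-- ★ **Thin-numerator bound, gauged form.**  For affine `A`, `B` with `det A ≡ c ≠ 0`, every constant `G`, scalar `λ`
and point `p`: `rank Hess_p tr(adj A·B) ≤ 2·m·rank B'(p) + 2·rank coeff(B')` for the gauged numerator
`B' = B + (A·G − G·A) + λ·A`. [folklore] -/
theorem rank_hess0_transl_trace_adjugate_mul_le_numerator_gauge (A B : Matrix (Fin m) (Fin m) (MvPolynomial σ ℂ))
    (hA : ∀ i j, (A i j).totalDegree ≤ 1) (hB : ∀ i j, (B i j).totalDegree ≤ 1) {c : ℂ} (hc : c ≠ 0)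
    (hdet : A.det = C c) (G : Matrix (Fin m) (Fin m) ℂ) (l : ℂ) (p : σ → ℂ) :
    (hess0 (transl p (A.adjugate * B).trace)).rank ≤
      2 * (m * ((B + (A * G.map (C : ℂ → MvPolynomial σ ℂ) - G.map (C : ℂ → MvPolynomial σ ℂ) * A) + (C l : MvPolynomial σ ℂ) • A).map (eval p)).rank) +
        2 * (Matrix.of fun (lk : Fin m × Fin m) (t : σ) =>
          coeff (Finsupp.single t 1) ((B + (A * G.map (C : ℂ → MvPolynomial σ ℂ) - G.map (C : ℂ → MvPolynomial σ ℂ) * A) + (C l : MvPolynomial σ ℂ) • A) lk.1 lk.2)).rank := by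
  rw [← hess0_transl_trace_adjugate_mul_gauge A B hdet G l p]
  exact rank_hess0_transl_trace_adjugate_mul_le_numerator A _ hA (isAffine_gauge A B hA hB G l) hc hdet p

end Gauge

/-! ### §7 The bound in the constrained-pencil (resolvent) currency -/

section Pencil

open Summit.ValiantsHypothesis.ValiantsHypothesis.Cruxes.TwoDimCoefficients.DimTwoCases
  (AffMat IsAffine isAffine_one_sub exists_det_one_sub_eq_C trace_adjugate_one_sub_mul)

variable {n m : ℕ}

/-- ★ **Thin-numerator bound for the resolvent trace of a nilpotent pencil.**  For an affine `m × m` pencil `N` over the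
`n²` coordinates with `N^m = 0` and an affine `M`, at every point `p`:
`rank Hess_p (Σ_{j<m} tr(N^j·M)) ≤ 2·m·rank M(p) + 2·rank coeff(M)`
(`Σ_j tr(N^j M) = c⁻¹·tr(adj(1 − N)·M)` with `det(1 − N) = c ≠ 0`, ✓ `trace_adjugate_one_sub_mul`). [folklore] -/
theorem rank_hess0_transl_resolvent_le_numerator (N M : AffMat n m) (hN : IsAffine N) (hM : IsAffine M)
    (hnil : N ^ m = 0) (p : Fin n × Fin n → ℂ) :
    (hess0 (transl p (∑ j ∈ Finset.range m, (N ^ j * M).trace))).rank ≤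
      2 * (m * (M.map (eval p)).rank) +
        2 * (Matrix.of fun (lk : Fin m × Fin m) (t : Fin n × Fin n) => coeff (Finsupp.single t 1) (M lk.1 lk.2)).rank := by
  obtain ⟨c, hc, hdet⟩ := exists_det_one_sub_eq_C N hnil
  have hsum : ∑ j ∈ Finset.range m, (N ^ j * M).trace = C c⁻¹ * ((1 - N).adjugate * M).trace := by
    rw [trace_adjugate_one_sub_mul N M hnil, hdet, ← mul_assoc, ← C_mul, inv_mul_cancel₀ hc, C_1, one_mul]
  rw [hsum, map_mul, transl_C, hess0_C_mul]
  exact (rank_smul_le _ _).trans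
    (rank_hess0_transl_trace_adjugate_mul_le_numerator (1 - N) M (isAffine_one_sub N hN) hM hc hdet p)

end Pencil

/-! ### §8 (appended) Per-side reading with gauge: the MR-point dichotomy for every gauge-equivalent numerator -/

section PerGauge

open Summit.ValiantsHypothesis.ValiantsHypothesis.Cruxes.TwoDimCoefficients.DimTwoCases (perPoly_ne_C)

variable {m : ℕ}

/-- **Per-side reading, gauged.**  If `per_n = α·det A + β·tr(adj A·B)` (`n = k + 3`) with `A`, `B` affine `m × m` and
`det A ≡ c ≠ 0`, then for EVERY constant matrix `G` and scalar `λ`, at the Mignon–Ressayre point `p₀`: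
`n² ≤ 2·m·rank B'(p₀) + 2·rank coeff(B')`, `B' = B + (A·G − G·A) + λ·A`.  (So a numerator that can be gauged thin at `p₀`
must carry `≥ n²/4 − m·rank B'(p₀)` independent linear forms after the gauge; at a point where `A(p₀) = A₀(1 + N₀)` with
`N₀` nilpotent, a Jordan-chain gauge achieves `rank(B(p₀) + [A(p₀), G]) ≤ #`Jordan blocks of `N₀` — paper remark, not typed.)
[folklore] -/
theorem sq_le_numerator_gauge_of_repr (k : ℕ) {α β c : ℂ}
    (A B : Matrix (Fin m) (Fin m) (MvPolynomial (Fin (k + 3) × Fin (k + 3)) ℂ))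
    (hA : ∀ i j, (A i j).totalDegree ≤ 1) (hB : ∀ i j, (B i j).totalDegree ≤ 1) (hc : c ≠ 0)
    (hdet : A.det = C c)
    (hper : perPoly (Fin (k + 3)) ℂ = C α * A.det + C β * (A.adjugate * B).trace)
    (G : Matrix (Fin m) (Fin m) ℂ) (l : ℂ) :
    (k + 3) ^ 2 ≤
      2 * (m * ((B + (A * G.map (C : ℂ → MvPolynomial (Fin (k + 3) × Fin (k + 3)) ℂ) -
          G.map (C : ℂ → MvPolynomial (Fin (k + 3) × Fin (k + 3)) ℂ) * A) +
          (C l : MvPolynomial (Fin (k + 3) × Fin (k + 3)) ℂ) • A).map (eval (mrPoint ℂ k))).rank) +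
        2 * (Matrix.of fun (lk : Fin m × Fin m) (t : Fin (k + 3) × Fin (k + 3)) =>
          coeff (Finsupp.single t 1) ((B + (A * G.map (C : ℂ → MvPolynomial (Fin (k + 3) × Fin (k + 3)) ℂ) -
            G.map (C : ℂ → MvPolynomial (Fin (k + 3) × Fin (k + 3)) ℂ) * A) +
            (C l : MvPolynomial (Fin (k + 3) × Fin (k + 3)) ℂ) • A) lk.1 lk.2)).rank := by
  set T : MvPolynomial (Fin (k + 3) × Fin (k + 3)) ℂ := (A.adjugate * B).trace with hT
  -- `β ≠ 0`: otherwise the permanent would be the constant `α c`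
  have hβ : β ≠ 0 := by
    intro hβ0
    apply perPoly_ne_C (n := k + 3) (by omega) (α * c)
    rw [hper, hdet, hβ0, map_zero, zero_mul, add_zero, ← C_mul]
  have e1 : transl (mrPoint ℂ k) (perPoly (Fin (k + 3)) ℂ) =
      MvPolynomial.C (α * c) + MvPolynomial.C β * transl (mrPoint ℂ k) T := by
    rw [hper, hdet, map_add, map_mul, map_mul, transl_C, transl_C, transl_C, ← C_mul]
  have hHess : hess0 (transl (mrPoint ℂ k) (perPoly (Fin (k + 3)) ℂ)) =
      β • hess0 (transl (mrPoint ℂ k) T) := by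
    rw [e1, map_add, hess0_C_mul,
      hess0_eq_zero_of_totalDegree_le_one (by rw [totalDegree_C]; exact Nat.zero_le _), zero_add]
  have hrank : (hess0 (transl (mrPoint ℂ k) T)).rank = (k + 3) ^ 2 := by
    rw [← rank_smul_eq hβ, ← hHess, hess0_transl_mrPoint_perPoly,
      rank_smul_eq (by exact_mod_cast Nat.factorial_ne_zero k), rank_mrHess]
  rw [← hrank, hT]
  exact rank_hess0_transl_trace_adjugate_mul_le_numerator_gauge A B hA hB hc hdet G l (mrPoint ℂ k)

end PerGauge

/-! ### §9 (appended) Row-factored numerators `B = U(x)·V₀`: `rank Hess_p ≤ 4·m·r` at every point -/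

section RowFactored

variable {σ : Type*} [Fintype σ] [DecidableEq σ] {m r : ℕ}

omit [DecidableEq σ] in
/-- The coefficient matrix of a row-factored numerator `B = U·V₀` (`U` affine `m × r`, `V₀` constant `r × m`) has rank
`≤ m·r`: it factors through the `(m·r) × σ` coefficient matrix of `U`. [folklore] -/
theorem rank_coeff_mul_map_C_le (U : Matrix (Fin m) (Fin r) (MvPolynomial σ ℂ)) (V₀ : Matrix (Fin r) (Fin m) ℂ) :
    (Matrix.of fun (lk : Fin m × Fin m) (t : σ) =>
        coeff (Finsupp.single t 1) ((U * V₀.map (C : ℂ → MvPolynomial σ ℂ)) lk.1 lk.2)).rank ≤ m * r := by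
  classical
  set LU : Matrix (Fin m × Fin r) σ ℂ := Matrix.of fun lq t => coeff (Finsupp.single t 1) (U lq.1 lq.2) with hLU
  set E : Matrix (Fin m × Fin m) (Fin m × Fin r) ℂ :=
    Matrix.of fun lk lq => if lk.1 = lq.1 then V₀ lq.2 lk.2 else 0 with hE
  have hfac : (Matrix.of fun (lk : Fin m × Fin m) (t : σ) =>
      coeff (Finsupp.single t 1) ((U * V₀.map (C : ℂ → MvPolynomial σ ℂ)) lk.1 lk.2)) = E * LU := by
    refine Matrix.ext fun lk t => ?_
    simp only [hE, hLU, Matrix.of_apply, Matrix.mul_apply, Matrix.map_apply, coeff_sum, Fintype.sum_prod_type,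
      ite_mul, zero_mul]
    rw [Finset.sum_comm]
    simp only [Finset.sum_ite_eq, Finset.mem_univ, if_true]
    exact Finset.sum_congr rfl fun q _ => by rw [mul_comm (U lk.1 q), MvPolynomial.coeff_C_mul]
  rw [hfac]
  refine (Matrix.rank_mul_le_right _ _).trans ((Matrix.rank_le_card_height LU).trans ?_)
  simp

omit [Fintype σ] [DecidableEq σ] in
/-- A row-factored numerator is affine when `U` is. [folklore] -/
theorem totalDegree_mul_map_C_le_one (U : Matrix (Fin m) (Fin r) (MvPolynomial σ ℂ))
    (hU : ∀ i q, (U i q).totalDegree ≤ 1) (V₀ : Matrix (Fin r) (Fin m) ℂ) (i j : Fin m) :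
    ((U * V₀.map (C : ℂ → MvPolynomial σ ℂ)) i j).totalDegree ≤ 1 := by
  rw [Matrix.mul_apply]
  refine (totalDegree_finsetSum _ _).trans (Finset.sup_le fun q _ => ?_)
  rw [Matrix.map_apply]
  exact (totalDegree_mul _ _).trans (by rw [totalDegree_C, add_zero]; exact hU i q)

/-- ★ **(H) for row-factored numerators, Hessian currency.**  If `A` is affine with `det A ≡ c ≠ 0` and the numerator factors
as `B = U(x)·V₀` with `U` affine `m × r` and `V₀` a CONSTANT `r × m` matrix (the hypothesis shape of the tree's transfer rung
✓ `sq_le_of_dualUnipotentRepr_rank`, `n² ≤ 2(m·r + 1)`), then at EVERY point `p`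
`rank Hess_p tr(adj A·B) ≤ 2·m·r + 2·m·r = 4·m·r` (pointwise rank `≤ r`, coefficient rank `≤ m·r`).  So the HessianRate
hypothesis `hC` of ✓ `threeHalves_of_hessianRate` holds on this family with `C·m² := 4·m·r·d`. [folklore] -/
theorem rank_hess0_transl_trace_adjugate_mul_le_of_rowFactored (A : Matrix (Fin m) (Fin m) (MvPolynomial σ ℂ))
    (U : Matrix (Fin m) (Fin r) (MvPolynomial σ ℂ)) (V₀ : Matrix (Fin r) (Fin m) ℂ)
    (hA : ∀ i j, (A i j).totalDegree ≤ 1) (hU : ∀ i q, (U i q).totalDegree ≤ 1) {c : ℂ} (hc : c ≠ 0)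
    (hdet : A.det = C c) (p : σ → ℂ) :
    (hess0 (transl p (A.adjugate * (U * V₀.map (C : ℂ → MvPolynomial σ ℂ))).trace)).rank ≤ 4 * (m * r) := by
  have h := rank_hess0_transl_trace_adjugate_mul_le_numerator A (U * V₀.map (C : ℂ → MvPolynomial σ ℂ)) hA
    (totalDegree_mul_map_C_le_one U hU V₀) hc hdet p
  have h1 : ((U * V₀.map (C : ℂ → MvPolynomial σ ℂ)).map (eval p)).rank ≤ r := by
    rw [Matrix.map_mul]
    refine (Matrix.rank_mul_le_left _ _).trans ((Matrix.rank_le_width _).trans ?_)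
    simp
  have h2 := rank_coeff_mul_map_C_le U V₀
  calc (hess0 (transl p (A.adjugate * (U * V₀.map (C : ℂ → MvPolynomial σ ℂ))).trace)).rank
      ≤ 2 * (m * ((U * V₀.map (C : ℂ → MvPolynomial σ ℂ)).map (eval p)).rank) +
        2 * (Matrix.of fun (lk : Fin m × Fin m) (t : σ) =>
          coeff (Finsupp.single t 1) ((U * V₀.map (C : ℂ → MvPolynomial σ ℂ)) lk.1 lk.2)).rank := h
    _ ≤ 2 * (m * r) + 2 * (m * r) := Nat.add_le_add (Nat.mul_le_mul_left _ (Nat.mul_le_mul_left _ h1))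
        (Nat.mul_le_mul_left _ h2)
    _ = 4 * (m * r) := by ring

end RowFactored

end Summit.ValiantsHypothesis.ValiantsHypothesis.Theorems.GrenetZeon.ThinNumerator

end
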